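/-
Copyright (c) 2026 the pub-hodgecm-mathlib formalisation cell (harness21).  Prover seat hodgecm-mathlib-K2E3-p12 (g2), Track B «K2-LIT» ∕ h413
(`stmt-HodgeConjecture-24833`), line `K2_E3_EllipticInputs`, unit U12-d «Harish-Chandra characters»: ON THE MODEL `GL_N(F)` OVER A LOCAL FIELD, the statement
«`|D|^{1∕2} Θ_π` bounded near `1`» (the split-place input of ★ `K2E3NormalizedCharBddNearSemisimpleModelTransport`) FROM its Lie-algebra form on `𝔤𝔩_N(F)`, and that form
FROM the two Lie-algebra core statements (L-A) «local expansion at `1` in `T̂`-form» and (L-B) «Thm 4.4 for `J(𝒩)`» — every `N`, no new definition.  2026-09-04.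
-/
import Summits.HodgeConjecture.HodgeConjecture.Theorems.K2E3CayleySliceCoversNhdsCentral      -- ★ (K2E1b-p15): inverse-Cayley kit `cayley_invCayley`, `isUnit_one_sub∕add_invCayley` (any commutative ring)
import Summits.HodgeConjecture.HodgeConjecture.Theorems.K2E3CayleyCharpolyDiscr               -- ★ p855189 (K2E3-p12 g0): `unit_mul_det_pow_eq_of_cayley`, `discr_charpoly_cayley_mul_det_pow`
import Literature.NumberTheory.Automorphic.LocalRingUnitModulusProduct                        -- ★ `distribHaarChar_eq_normAbs` (`‖u‖_F = |u|_F`)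
import Literature.NumberTheory.Automorphic.LocalFieldHaarBalls                                -- ★ `LocalFieldHaar.continuous_normAbs`
import Literature.NumberTheory.Rogawski1990.LocalTransferFundamentalLemma                     -- ★ `IsLocSmooth`
import Literature.LinearAlgebra.Matrix.CharpolyDiscTwinBridge                                 -- ★ `isUnit_discr_iff_separable_of_monic`
import Mathlib.Topology.Instances.Matrix
import HarnessLib

/-!
# K2_E3 road (h413 = stmt-HodgeConjecture-24833), unit U12-d on the model `GL_N(F)` — «`|D_{GL_N}|^{1∕2}·Θ` BOUNDED NEAR `1`» ⟸ ITS LIE FORM ⟸ (L-A) + (L-B)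

Cell `pub/hodgecm-mathlib` (D-0151), Track B (21-frontier RULING «PUSH BOTH» 2026-09-03, director req624), seat K2E3-p12 (g2), line lead of row 12 (12-S).
`--supports stmt-HodgeConjecture-24833 --as helper`; THEOREMS ONLY (no definition ∕ instance ∕ notation ∕ named fact ∕ `sorry`); never imports `Cruxes/…/Lines`.

After ★ p856143∕p856182 the split-place half of socket U12-d is the statement (12-GL) on `G₀ = GL_N(L_w)`: «for `Θ₀` locally constant at the regular points (and
representing an admissible character): `∃ U₀ ∋ 1` open, `∃ B`, `√‖u₀‖·|Θ₀ g| ≤ B` for `g ∈ U₀`, `u₀·det(g)^{N−1} = disc χ_g`» — Harish-Chandra's Thm. 16.3 (2) at `γ = 1`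
for `GL_N` over the local field `F = L_w` [HarishChandra1999, Thm. 16.3; Howe1974].  This file, GENERIC over a non-archimedean local field `F` with `2 ≠ 0`, proves:
* §1 **`normalizedCharBddNearOne_of_lieBound`** — (12-GL) ⟸ (12-GL-Lie) «`∃ V ∋ 0` in `M_N(F)`, `∃ B`, `√|disc χ_Y|_F·|Θ₀ g| ≤ B` whenever `g = c(Y) = (1+Y)(1−Y)⁻¹`, `Y ∈ V`,
  `1 ± Y` invertible»: the inverse Cayley chart `Y = (g−1)(g+1)⁻¹` near `1` (★ `cayley_invCayley`), `u₀·(det(1−Y)det(1+Y))^{N−1} = 2^{N(N−1)} disc χ_Y` (★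
  `unit_mul_det_pow_eq_of_cayley`), the unit factor `> 1∕2` near `0`, `‖u₀‖_F = |u₀|_F` (★ `distribHaarChar_eq_normAbs`).  (`|η_{𝔤𝔩_N}(Y)|_F = |disc χ_Y|_F`.)
* §2 **`lieBound_of_lieCore`** — (12-GL-Lie) ⟸ the two LIE-ALGEBRA CORE statements on `𝔤 = M_N(F)` with its additive Haar measure `μ𝔤`, a character `ψ` of `F` and the Fourier
  transform `𝓕f(Y) = ∫ ψ(tr(YX)) f(X) dμ𝔤(X)` [HC1999 p. 11], stated for INVARIANT DISTRIBUTIONS SUPPORTED IN THE NILPOTENT CONE (`T` linear on `C_c^∞(𝔤)`, `Ad(G₀)`-invariant,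
  `T f = 0` when `supp f` misses the nilpotent matrices = HC's `J(𝒩)`):
  (L-A) «LOCAL EXPANSION AT `1` IN `T̂`-FORM» [HC1999 §21 p. 87 «`θ₀ = τ̂` on `Λ`, `τ ∈ J₀`» at `γ = 1`; Howe1974 Prop. 3 for `GL_n`]: `∃ V ∋ 0`, `∃ T ∈ J(𝒩)`, for every `F_T`
  representing `T̂` (`T(𝓕f) = ∫ f·F_T`) and locally constant at the regular points: `Θ₀(c(Y)) = F_T(Y)` for regular `Y ∈ V`;
  (L-B) «THM. 4.4 FOR `J(𝒩)`» [HC1999 Thm. 4.4 p. 11: `T̂ = F_T`, `F_T` locally constant on `𝔤′`, «(3) `|η|^{1∕2}·F` is locally bounded»]: every `T ∈ J(𝒩)` has such an `F_T`,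
  locally integrable, with `√|disc χ_X|_F·|F_T(X)|` bounded on compacta.
So on `GL_N(F)` — hence (★ transports) at the split places of U12-d — Harish-Chandra's bound costs exactly (L-A) + (L-B), both statements of Fourier analysis on
`M_N(F)` typeable in Mathlib vocabulary (no new definition), with Howe 1974 as the printed road for `GL_n`.  The non-split twin needs the carrier `𝔲(σ_w,H_w) ⊂ M_N(L_w)`
(SPEC `K2/K2E3-p12/g2/SPEC-LieCore-U12.v1`).  [HarishChandra1999AdmissibleDistributions, Thm. 4.4 p. 11, Thm. 16.3 p. 77, §17, §21 p. 87] [Howe1974, Prop. 3, Lemma 4]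
[PlatonovRapinchuk1994, §3.3].
HONEST LABEL: HC_CM is proved only modulo the 7 printed citations (2 remaining named inputs: hLiu418 = stmt-HodgeConjecture-24832, h413 =
stmt-HodgeConjecture-24833) until rung 0 closes; compositions only — (L-A), (L-B) are NOT proved here.

## References
* [HarishChandra1999AdmissibleDistributions] Harish-Chandra (DeBacker–Sally), *Admissible Invariant Distributions on Reductive p-adic Groups* (1999), Thm. 4.4, Thm. 16.3, §21.
* [Howe1974] R. Howe, *The Fourier transform and germs of characters (case of GL_n over a p-adic field)*, Math. Ann. 208 (1974), 305–322, Prop. 3, Lemma 4.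
* [PlatonovRapinchuk1994] V. Platonov, A. Rapinchuk, *Algebraic Groups and Number Theory* (1994), §3.3 (Cayley parametrisation).
-/

set_option autoImplicit false
set_option linter.dupNamespace false   -- `Summit.HodgeConjecture.HodgeConjecture.…` (D-0017 nested layout; lakefile exemption for Summits)

noncomputable section

open MeasureTheory Filter Topology Polynomial
open scoped Matrix MatrixGroups NNReal
open Literature.NumberTheory.Rogawski1990 Literature.NumberTheory.Automorphic Literature.NumberTheory.Automorphic.UnitaryGroup
open Literature.NumberTheory.GaloisRepresentations Literature.NumberTheory.GaloisRepresentations.IsNonarchimedeanLocalField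
open Summit.HodgeConjecture.HodgeConjecture.Cruxes.H413.K2E3CayleySliceCoversNhdsCentral
open Summit.HodgeConjecture.HodgeConjecture.Cruxes.H413.K2E3CayleyCharpolyDiscr

namespace Summit.HodgeConjecture.HodgeConjecture.Cruxes.H413.K2E3GLnNormalizedCharBddNearIdentityOfLieCore

variable {F : Type*} [Field F] [ValuativeRel F] [TopologicalSpace F] [IsNonarchimedeanLocalField F] {N : ℕ}

/-! ## §1  (12-GL) from its Lie form, through the inverse Cayley chart at `1` -/

/-- The unit factor `|(det(1−Y)·det(1+Y))^{N−1}|_F` is continuous in `Y` and equals `1` at `Y = 0` (★ `continuous_normAbs`). [folklore] -/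
theorem continuous_detFactorF :
    Continuous fun Y : Matrix (Fin N) (Fin N) F => normAbs F (((1 - Y).det * (1 + Y).det) ^ (N - 1)) := by
  have h1 : Continuous fun Y : Matrix (Fin N) (Fin N) F => (1 - Y).det := continuous_id.matrix_det.comp (continuous_const.sub continuous_id)
  have h2 : Continuous fun Y : Matrix (Fin N) (Fin N) F => (1 + Y).det := continuous_id.matrix_det.comp (continuous_const.add continuous_id)
  exact LocalFieldHaar.continuous_normAbs.comp ((h1.mul h2).pow _)

/-- The inverse Cayley map `M ↦ (M − 1)(M + 1)⁻¹` is continuous at `M = 1` (where `det(M + 1) = 2^N ≠ 0`; Mathlib `continuousAt_matrix_inv`). [cite: PlatonovRapinchuk1994, §3.3] -/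
theorem continuousAt_invCayley (h2 : (2 : F) ≠ 0) :
    ContinuousAt (fun M : Matrix (Fin N) (Fin N) F => (M - 1) * (M + 1)⁻¹) 1 := by
  have hdet : ((1 : Matrix (Fin N) (Fin N) F) + 1).det ≠ 0 := by
    rw [show ((1 : Matrix (Fin N) (Fin N) F) + 1) = (2 : F) • (1 : Matrix (Fin N) (Fin N) F) by rw [two_smul], Matrix.det_smul, Matrix.det_one, mul_one]
    exact pow_ne_zero _ h2
  have hinv : ContinuousAt (fun M : Matrix (Fin N) (Fin N) F => (M + 1)⁻¹) 1 := by
    have h1 : ContinuousAt Inv.inv ((1 : Matrix (Fin N) (Fin N) F) + 1) := by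
      refine continuousAt_matrix_inv _ ?_
      rw [Ring.inverse_eq_inv']
      exact continuousAt_inv₀ hdet
    exact ContinuousAt.comp (g := Inv.inv) h1 (continuousAt_id.add continuousAt_const)
  exact (continuousAt_id.sub continuousAt_const).mul hinv

set_option maxHeartbeats 800000 in
/-- **(12-GL) ⟸ (12-GL-Lie) on `GL_N(F)`** (`F` a non-archimedean local field with `2 ≠ 0`; `Θ₀ : GL_N(F) → ℂ` arbitrary): if `√|disc χ_Y|_F·|Θ₀(c(Y))| ≤ B` for `Y` near `0`
(`c(Y) = (1+Y)(1−Y)⁻¹`), then `√‖u₀‖_F·|Θ₀ g| ≤ B′` for `g` near `1` and every `u₀` with `u₀·det(g)^{N−1} = disc χ_g`: read `g = c(Y)`, `Y = (g−1)(g+1)⁻¹` (★ `cayley_invCayley`),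
`‖u₀‖_F·|(det(1−Y)det(1+Y))^{N−1}|_F = |2|_F^{N(N−1)}·|disc χ_Y|_F` (★ `unit_mul_det_pow_eq_of_cayley`, ★ `distribHaarChar_eq_normAbs`), unit factor `> 1∕2` near `Y = 0`;
`B′ = √(2·|2|_F^{N(N−1)})·max B 0`. [cite: HarishChandra1999AdmissibleDistributions, Thm. 16.3 p. 77, §17] [cite: PlatonovRapinchuk1994, §3.3] -/
theorem normalizedCharBddNearOne_of_lieBound (h2 : (2 : F) ≠ 0) (Θ₀ : GL (Fin N) F → ℂ)
    (hLie : ∃ V : Set (Matrix (Fin N) (Fin N) F), V ∈ 𝓝 (0 : Matrix (Fin N) (Fin N) F) ∧ ∃ B : ℝ, ∀ g : GL (Fin N) F, ∀ Y ∈ V,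
      IsUnit (1 - Y) → IsUnit (1 + Y) → (g : Matrix (Fin N) (Fin N) F) = (1 + Y) * (1 - Y)⁻¹ →
      ((NNReal.sqrt (normAbs F Y.charpoly.discr) : ℝ≥0) : ℝ) * ‖Θ₀ g‖ ≤ B) :
    ∃ U₀ : Set (GL (Fin N) F), IsOpen U₀ ∧ (1 : GL (Fin N) F) ∈ U₀ ∧ ∃ B : ℝ, ∀ g ∈ U₀, ∀ u₀ : Fˣ,
      (u₀ : F) * (((g : Matrix (Fin N) (Fin N) F)).det) ^ (N - 1) = ((g : Matrix (Fin N) (Fin N) F)).charpoly.discr →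
      ((NNReal.sqrt (unitModulusChar F u₀) : ℝ≥0) : ℝ) * ‖Θ₀ g‖ ≤ B := by
  obtain ⟨V, hV, B, hB⟩ := hLie
  have ht : (2 : F) * (2 : F)⁻¹ = 1 := mul_inv_cancel₀ h2
  -- the unit factor and its lower bound near `0`
  set Mf : Matrix (Fin N) (Fin N) F → ℝ≥0 := fun Y => normAbs F (((1 - Y).det * (1 + Y).det) ^ (N - 1)) with hMf
  have hMc : Continuous Mf := continuous_detFactorF
  have hM0 : Mf 0 = 1 := by simp only [hMf, sub_zero, add_zero, Matrix.det_one, mul_one, one_pow, map_one]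
  have hVM : Mf ⁻¹' Set.Ioi (1 / 2) ∈ 𝓝 (0 : Matrix (Fin N) (Fin N) F) := by
    refine (hMc.isOpen_preimage _ isOpen_Ioi).mem_nhds ?_
    rw [Set.mem_preimage, hM0, Set.mem_Ioi]
    exact one_half_lt_one
  -- the inverse Cayley chart near `1`
  set ic : Matrix (Fin N) (Fin N) F → Matrix (Fin N) (Fin N) F := fun M => (M - 1) * (M + 1)⁻¹ with hic
  have hic0 : ic 1 = 0 := by simp only [hic, sub_self, zero_mul]
  have hicc : ContinuousAt (fun g : GL (Fin N) F => ic (g : Matrix (Fin N) (Fin N) F)) 1 := by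
    have h := continuousAt_invCayley (N := N) h2
    rw [← Units.val_one] at h
    exact h.comp Units.continuous_val.continuousAt
  set W : Set (GL (Fin N) F) := {g | IsUnit (((g : Matrix (Fin N) (Fin N) F)) + 1).det} ∩
    (fun g : GL (Fin N) F => ic (g : Matrix (Fin N) (Fin N) F)) ⁻¹' (V ∩ Mf ⁻¹' Set.Ioi (1 / 2)) with hW
  have hW1 : W ∈ 𝓝 (1 : GL (Fin N) F) := by
    refine Filter.inter_mem ?_ (hicc.preimage_mem_nhds (by rw [Units.val_one, hic0]; exact Filter.inter_mem hV hVM))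
    haveI : T2Space F := (Literature.NumberTheory.GaloisRepresentations.IsNonarchimedeanLocalField.isLocalField F).toT2Space
    have hopen : IsOpen {g : GL (Fin N) F | IsUnit (((g : Matrix (Fin N) (Fin N) F)) + 1).det} := by
      have hc : Continuous fun g : GL (Fin N) F => (((g : Matrix (Fin N) (Fin N) F)) + 1).det :=
        (Units.continuous_val.add continuous_const).matrix_det
      simp_rw [isUnit_iff_ne_zero]
      exact isOpen_ne_fun hc continuous_const
    refine hopen.mem_nhds ?_
    change IsUnit ((((1 : GL (Fin N) F) : Matrix (Fin N) (Fin N) F)) + 1).det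
    rw [Units.val_one, show ((1 : Matrix (Fin N) (Fin N) F) + 1) = (2 : F) • (1 : Matrix (Fin N) (Fin N) F) by rw [two_smul], Matrix.det_smul,
      Matrix.det_one, mul_one]
    exact isUnit_iff_ne_zero.2 (pow_ne_zero _ h2)
  -- the constant
  set K : ℝ≥0 := normAbs F ((2 : F) ^ (N * (N - 1))) with hK
  refine ⟨interior W, isOpen_interior, mem_interior_iff_mem_nhds.2 hW1, ((NNReal.sqrt (2 * K) : ℝ≥0) : ℝ) * max B 0, fun g hg u₀ hu => ?_⟩
  obtain ⟨hP, hYV, hYM⟩ := interior_subset hg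
  set Y : Matrix (Fin N) (Fin N) F := ic (g : Matrix (Fin N) (Fin N) F) with hYdef
  have hY1 : IsUnit (1 - Y) := isUnit_one_sub_invCayley _ hP ht
  have hY2 : IsUnit (1 + Y) := isUnit_one_add_invCayley _ (Matrix.isUnits_det_units g) hP ht
  have hgY : ((g : Matrix (Fin N) (Fin N) F)) = (1 + Y) * (1 - Y)⁻¹ := (cayley_invCayley _ hP ht).symm
  have hLie := hB g Y hYV hY1 hY2 hgY
  -- the weight comparison
  have hu' : (u₀ : F) * (((1 + Y) * (1 - Y)⁻¹).det) ^ (N - 1) = ((1 + Y) * (1 - Y)⁻¹).charpoly.discr := by rw [← hgY]; exact hu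
  have hid := unit_mul_det_pow_eq_of_cayley Y ((Matrix.isUnit_iff_isUnit_det _).1 hY1) (u₀ : F) hu'
  have hmod : unitModulusChar F u₀ * Mf Y = K * normAbs F Y.charpoly.discr := by
    rw [unitModulusChar, distribHaarChar_eq_normAbs, hMf, hK, ← map_mul, ← map_mul, hid]
  set D : ℝ≥0 := normAbs F Y.charpoly.discr with hD
  have hle : unitModulusChar F u₀ ≤ 2 * K * D := by
    have h2' : unitModulusChar F u₀ * (1 / 2) ≤ unitModulusChar F u₀ * Mf Y := mul_le_mul_of_nonneg_left hYM.le (zero_le)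
    rw [hmod] at h2'
    calc unitModulusChar F u₀ = unitModulusChar F u₀ * (1 / 2) * 2 := by rw [mul_assoc, one_div, inv_mul_cancel₀ (two_ne_zero), mul_one]
      _ ≤ K * D * 2 := mul_le_mul_of_nonneg_right h2' (zero_le)
      _ = 2 * K * D := by ring
  have hsqrt : NNReal.sqrt (unitModulusChar F u₀) ≤ NNReal.sqrt (2 * K) * NNReal.sqrt D := by
    rw [← NNReal.sqrt_mul]
    exact NNReal.sqrt_le_sqrt.2 hle
  have hB0 : B ≤ max B 0 := le_max_left _ _
  calc ((NNReal.sqrt (unitModulusChar F u₀) : ℝ≥0) : ℝ) * ‖Θ₀ g‖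
      ≤ (((NNReal.sqrt (2 * K) * NNReal.sqrt D : ℝ≥0)) : ℝ) * ‖Θ₀ g‖ := mul_le_mul_of_nonneg_right (NNReal.coe_le_coe.2 hsqrt) (norm_nonneg _)
    _ = ((NNReal.sqrt (2 * K) : ℝ≥0) : ℝ) * ((((NNReal.sqrt D) : ℝ≥0) : ℝ) * ‖Θ₀ g‖) := by rw [NNReal.coe_mul, mul_assoc]
    _ ≤ ((NNReal.sqrt (2 * K) : ℝ≥0) : ℝ) * max B 0 := mul_le_mul_of_nonneg_left (hLie.trans hB0) (NNReal.coe_nonneg _)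

/-! ## §2  The Lie form from the Lie-algebra core (L-A) + (L-B) on `𝔤𝔩_N(F)` -/

set_option maxHeartbeats 800000 in
/-- **(12-GL-Lie) ⟸ (L-A) + (L-B).**  Frame: `𝔤 = M_N(F)` with an additive Haar measure `μ𝔤`, a character `ψ : F → ℂ`, the Fourier transform
`𝓕 f (Y) = ∫ ψ(tr(Y X))·f(X) dμ𝔤(X)`; `J(𝒩)` = the `Ad(GL_N(F))`-invariant linear functionals on `C_c^∞(𝔤)` vanishing on test functions supported off the nilpotent matrices.
`hA` = (L-A): a neighbourhood `V` of `0` and `T ∈ J(𝒩)` with `Θ₀(c(Y)) = F(Y)` for regular `Y ∈ V` (`c(Y)` the Cayley transform, `1 ± Y` units) for EVERY `F` representing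
`T̂` that is locally constant at the regular points; `hB` = (L-B): every `T ∈ J(𝒩)` has such an `F`, locally integrable, with `√|disc χ_X|_F·|F X|` bounded on every compact
set.  Conclusion: (12-GL-Lie) for `Θ₀`.  Proof: a compact neighbourhood `C ⊆ V` of `0`; at a regular `Y` the identity, at a non-regular `Y` the weight vanishes
(`disc χ_Y = 0`). [cite: HarishChandra1999AdmissibleDistributions, Thm. 4.4 p. 11, §21 p. 87] [cite: Howe1974, Prop. 3, Lemma 4] -/
theorem lieBound_of_lieCore [MeasurableSpace (Matrix (Fin N) (Fin N) F)] [BorelSpace (Matrix (Fin N) (Fin N) F)]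
    (μ𝔤 : Measure (Matrix (Fin N) (Fin N) F)) [μ𝔤.IsAddHaarMeasure] (ψ : F → ℂ) (Θ₀ : GL (Fin N) F → ℂ)
    (hA : ∃ V : Set (Matrix (Fin N) (Fin N) F), V ∈ 𝓝 (0 : Matrix (Fin N) (Fin N) F) ∧
      ∃ T : (Matrix (Fin N) (Fin N) F → ℂ) → ℂ,
        ((∀ f₁ f₂ : Matrix (Fin N) (Fin N) F → ℂ, IsLocSmooth f₁ → IsLocSmooth f₂ → T (f₁ + f₂) = T f₁ + T f₂) ∧
         (∀ (a : ℂ) (f : Matrix (Fin N) (Fin N) F → ℂ), IsLocSmooth f → T (a • f) = a * T f) ∧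
         (∀ (x : GL (Fin N) F) (f : Matrix (Fin N) (Fin N) F → ℂ), IsLocSmooth f →
            T (fun X => f ((x : Matrix (Fin N) (Fin N) F) * X * ((x⁻¹ : GL (Fin N) F) : Matrix (Fin N) (Fin N) F))) = T f) ∧
         (∀ f : Matrix (Fin N) (Fin N) F → ℂ, IsLocSmooth f → (∀ X ∈ tsupport f, ¬ IsNilpotent X) → T f = 0)) ∧
        ∀ Fn : Matrix (Fin N) (Fin N) F → ℂ,
          (∀ f : Matrix (Fin N) (Fin N) F → ℂ, IsLocSmooth f →
              T (fun Y => ∫ X, ψ (Matrix.trace (Y * X)) * f X ∂μ𝔤) = ∫ X, f X * Fn X ∂μ𝔤) →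
          (∀ X : Matrix (Fin N) (Fin N) F, IsUnit X.charpoly.discr → ∀ᶠ Y in 𝓝 X, Fn Y = Fn X) →
          ∀ g : GL (Fin N) F, ∀ Y ∈ V, IsUnit Y.charpoly.discr → IsUnit (1 - Y) → IsUnit (1 + Y) →
            (g : Matrix (Fin N) (Fin N) F) = (1 + Y) * (1 - Y)⁻¹ → Θ₀ g = Fn Y)
    (hB : ∀ T : (Matrix (Fin N) (Fin N) F → ℂ) → ℂ,
        ((∀ f₁ f₂ : Matrix (Fin N) (Fin N) F → ℂ, IsLocSmooth f₁ → IsLocSmooth f₂ → T (f₁ + f₂) = T f₁ + T f₂) ∧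
         (∀ (a : ℂ) (f : Matrix (Fin N) (Fin N) F → ℂ), IsLocSmooth f → T (a • f) = a * T f) ∧
         (∀ (x : GL (Fin N) F) (f : Matrix (Fin N) (Fin N) F → ℂ), IsLocSmooth f →
            T (fun X => f ((x : Matrix (Fin N) (Fin N) F) * X * ((x⁻¹ : GL (Fin N) F) : Matrix (Fin N) (Fin N) F))) = T f) ∧
         (∀ f : Matrix (Fin N) (Fin N) F → ℂ, IsLocSmooth f → (∀ X ∈ tsupport f, ¬ IsNilpotent X) → T f = 0)) →
        ∃ Fn : Matrix (Fin N) (Fin N) F → ℂ, LocallyIntegrable Fn μ𝔤 ∧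
          (∀ f : Matrix (Fin N) (Fin N) F → ℂ, IsLocSmooth f →
              T (fun Y => ∫ X, ψ (Matrix.trace (Y * X)) * f X ∂μ𝔤) = ∫ X, f X * Fn X ∂μ𝔤) ∧
          (∀ X : Matrix (Fin N) (Fin N) F, IsUnit X.charpoly.discr → ∀ᶠ Y in 𝓝 X, Fn Y = Fn X) ∧
          (∀ C : Set (Matrix (Fin N) (Fin N) F), IsCompact C → ∃ B : ℝ, ∀ X ∈ C,
              ((NNReal.sqrt (normAbs F X.charpoly.discr) : ℝ≥0) : ℝ) * ‖Fn X‖ ≤ B)) :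
    ∃ V : Set (Matrix (Fin N) (Fin N) F), V ∈ 𝓝 (0 : Matrix (Fin N) (Fin N) F) ∧ ∃ B : ℝ, ∀ g : GL (Fin N) F, ∀ Y ∈ V,
      IsUnit (1 - Y) → IsUnit (1 + Y) → (g : Matrix (Fin N) (Fin N) F) = (1 + Y) * (1 - Y)⁻¹ →
      ((NNReal.sqrt (normAbs F Y.charpoly.discr) : ℝ≥0) : ℝ) * ‖Θ₀ g‖ ≤ B := by
  obtain ⟨V, hV, T, hT, hTA⟩ := hA
  obtain ⟨Fn, -, hrepF, hlocF, hbd⟩ := hB T hT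
  -- a compact neighbourhood of `0` inside `V`
  haveI : LocallyCompactSpace (Matrix (Fin N) (Fin N) F) := inferInstanceAs (LocallyCompactSpace (Fin N → Fin N → F))
  obtain ⟨C, hCc, hC0⟩ := exists_compact_mem_nhds (0 : Matrix (Fin N) (Fin N) F)
  obtain ⟨B, hBC⟩ := hbd C hCc
  refine ⟨V ∩ C, Filter.inter_mem hV hC0, max B 0, fun g Y hY h1 h2 hg => ?_⟩
  by_cases hreg : IsUnit Y.charpoly.discr
  · rw [hTA Fn hrepF hlocF g Y hY.1 hreg h1 h2 hg]
    exact (hBC Y hY.2).trans (le_max_left _ _)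
  · have h0 : Y.charpoly.discr = 0 := by rwa [isUnit_iff_ne_zero, not_not] at hreg
    rw [h0, map_zero, NNReal.sqrt_zero, NNReal.coe_zero, zero_mul]
    exact le_max_right _ _

end Summit.HodgeConjecture.HodgeConjecture.Cruxes.H413.K2E3GLnNormalizedCharBddNearIdentityOfLieCore

end
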